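import Literature.MathematicalPhysics.QuantumFieldTheory.Balaban1983to89.Node00.BgRemainderOfRecord
import HarnessLib

/-!
# [B11] Prop. 6 (115)–(117) ∕ [B9] (3.128), (3.134): THE SCHEME OF RECORD — the `BgScheme` instance at a displayed background `U₀`, its `rfl`
# projections, and the displayed tokens it is read with ((3.134) defining `Δ⁽²⁾`; `DC^{𝔰𝔩}(0) = 0`; Prop. 6's regime)
# — OURS (definitional + `rfl`∕bookkeeping; file 3g′ of the record-pinned instance road `M2`; no inequality of Bałaban)

Cell `pub-ymgap`, unit `pub-ymgap-node00-def-Y` (g37; owner∕custodian of the `OpsY` instance at the record; Node00 definition lane;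
count-neutral, `--supports stmt-QuantumFields-27238`).  Third and last file of M2 (★★★ №528 (2)): 3d′ `BgCurrentOfRecord` (`J`), 3e′
`BgConstraintOfRecord` (`B`, `C`, `𝔄♭`), 3f′ `BgRemainderOfRecord` (slot-(c) `𝔊`, `H₁`, `𝔄`, `W`, `C^{𝔰𝔩}`) → 3g′ THIS FILE: the instance.

WHY.  `Node00.BackgroundMapOfRecord.BgScheme` ([B11] Prop. 6 AS DATA: `dom`, `bg`, `𝒢`, `W`, `J`, `𝔄`, the constants `B₀ C₄ a₃ j a ε₄`, the
presentation `ev`) had NO lattice instance in the tree (census 2026-08-31); its laws are the tokens `RegimeTok`, `ChartSUTok`, `Prop7Tok`,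
`UniqTok`, and its one theorem with content, `analyticOnNhd_sol_comp` («the equations determine an analytic function»), waits for an instance to
be ABOUT something.  This file assembles THE INSTANCE OF RECORD at a displayed background `U₀` (print's (14): «for k = 1 … U₀ = V₀»; in
general the previous step's minimiser — a DATUM here, `bg := fun _ ↦ U₀`) from the letters of files 3a–3f′, over the lit-side carriers
`𝒴 := Space115Lit F N K k Ω U₀`, `𝒵 := NegSizeLit F N K k Ω 3` (`BgSchemeOnLit`):
* `𝒢 := 𝔊(U₀)` of (111)∕(116) for the slot-(c) Hessian `π†(Δ(U₀) + Δ⁽²⁾)π` ([B9] (3.128)) — `frakGOfRecordAtBg128 Gp Δ2 a hposπ hQ` (3f′);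
* `W := W` of (80)∕(84) with `H := H♭` (Sect. C (45)–(47)), `C := C^{𝔰𝔩}` (the traceless slice), `J`, `Δπ` — `WOfRecordAt levB a hpos♭ hQ εC Gp` (3f′);
* `J := J(U₀)` of (26)–(28) — `JOfRecordAtBg` (3d′);  `𝔄 V := H₁B(V)` (103) for slot (c) — `frakAOfRecordAtBg128 levB Gp Δ2 a hposπ hQ V` (3f′, 3e′'s `B`);
* `ev := η·ev` — the (19) presentation `U′ = exp(iηA′)` of a jet `A′` on the record's bonds (`evLit`, 3b), scaled by `η = (F.P K).eta k` so that
  `BgScheme.expo` reads `exp(iηA′(b))` (CHECK-η of the cell's M2 plan);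
* the constants `B₀ C₄ a₃ j a ε₄` and the domain `dom` are DATA (print: (117)–(121); Prop. 6's smallness is `RegimeTok`, not a field).
The data letters are print's: `G′ =: Gp` ((3.24)–(3.25); n07's `greenK T′` at every background), `Δ⁽²⁾ =: Δ2` ((3.134)), the Landau
parameter `a` of (110), the level function `levB` of the `B`-carrier (20), the radius `ε_C` of Sect. C's chart.  The displayed PROOFS are
binders, TWO positivity letters kept apart (review seat RR-2, 2026-08-31): `hposπ` — [B9] Thm 3.12, positivity of (110)'s operator for the
slot-(c) Hessian (enters `𝒢`, `H₁`, `𝔄`); `hpos♭` — [B9] Thm 3.11 for the bare Hessian (enters Sect. C's `H♭` inside `W`); and `hQ` —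
surjectivity of `Q(U₀)`.  Nothing is chosen, nothing is existential: every slot is a closed term in the binders.

DICTIONARY (print ↦ here).  Prop. 6's data `(𝒢, W, J, 𝔄; B₀, C₄, a₃, j, a, ε₄)` at `U₀` ↦ `bgSchemeOfRecord … : BgSchemeOnLit F N K k Ω U₀`
(§1; projections `bgSchemeOfRecord_𝒢 ∕ _W ∕ _J ∕ _𝔄 ∕ _bg ∕ _ev`, all `rfl`); the fixed point `𝒜(V)` of (116) ↦ `(bgSchemeOfRecord …).sol V`
(`bgSchemeOfRecord_sol`, `rfl` to lit `solA`); [B9] (3.134) «`⟨A, Δ⁽²⁾A⟩ := −2⟨HC⁽²⁾(A), J⟩` defines the second quadratic form in (3.128)» ↦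
the token `Delta2Tok levB a hpos♭ hQ Δ2` (§2, over lit `pair27`∕`currentCLM`∕`flat115`∕`quadPart`); (44)∕(56) «`C` is of second order» on
print's `𝔤ᶜ`-valued fields ↦ the token `C1Tok levB : HasFDerivAt C^{𝔰𝔩} 0 0` (§2; `DC^{𝔰𝔩}(0) = 0` with differentiability, junk-proof); Prop. 6 (117)–(121) + (28) + (103) at the instance ↦
`(bgSchemeOfRecord …).RegimeTok` (3a's token, by name); the symmetry of `Δ(U₀) + Δ⁽²⁾` asked by [B9] (3.124)'s third identity ↦ `HessSymmTok Δ2`.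

CONTENTS.  §1 `bgSchemeOfRecord` + the `rfl` projections + `bgSchemeOfRecord_sol` + E2 `bgSchemeOfRecord_𝔄_self` (`𝔄(Ū^kU₀) = 0`, 3f′) and
`bgSchemeOfRecord_J_one` (`J(1) = 0`, 3d′).  §2 the displayed tokens `Delta2Tok`, `Delta2SymmTok`, `HessSymmTok`, `C1Tok`, and the bundle
`SchemeTokOfRecord` (= `RegimeTok ∧ ChartSUTok ∧ HessSymmTok ∧ C1Tok`, the text a statement row over the instance CONCLUDES — ceiling-first
constants, `∀` over the admissible data and the hypotheses `Delta2Tok`, `Delta2SymmTok` pinning `Δ2` are the ROW's binders, not this file's).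

HONEST LABELS.  Definitions, `rfl` projections, two E2 identities.  NOT asserted here: any token of §2, [B9] Thms 3.11–3.13 (`hposπ`, `hpos♭`,
(117)'s `B₀`), (g2) in general, Prop. 4 (98), (46)∕(103), (28) beyond 3d′'s `norm_JOfRecordAtBg_le`, Prop. 5∕(112), Prop. 6's conclusion
(lit ✓`B11Prop6Scheme.existsUnique_solution` APPLIES once `RegimeTok` is proved — a theorem for a prover, not a conjunct), Prop. 7, Thm 1; the
EXISTENCE of a `Δ2` with `Delta2Tok` (linear algebra over the transpose pairing; a support statement, not smuggled); and any `∃` over scheme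
data.  No `sorry`, no new axiom, no instance ∕ notation.  Nothing here is a claim about the Yang–Mills mass gap (`Summit.QuantumFields`): finite
torus, fixed `ε`; nothing continuum ∕ OS ∕ Clay.
-/

noncomputable section

open scoped Matrix Matrix.Norms.L2Operator InnerProductSpace ComplexConjugate

namespace Literature.MathematicalPhysics.QuantumFieldTheory.Balaban1983to89.Node00

open T4Continuum (T4Family)
open B4Sect5Torus (TSite)
open B9SectCLatticeCarrier (Bond)
open B9Eq311L2Pairing (WL2)
open B11Eq103H1Complex (BondL2K SiteL2K)
open B11Eq115Space (Space115 NegSize NegSup JetSup levWeight)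
open B11Eq111FrakG (nabla115)
open B11Eq90Transpose (pair27)
open B11Eq90V0primeCurrent (flat115)
open B9Eq3119DeltaPiCarrier (currentCLM)
open B11Eq80Current (quadPart)
open B11Eq174Chart (Regime solA)

section Record

variable (F : T4Family) (N : ℕ) [NeZero N] (K : ℕ) (k : ℕ) (Ω : ℕ → Set (Site (F.P K) 0)) (U₀ : GaugeField (F.P K) 0 (SU N))
variable [Fact (0 < (F.L : ℝ))] [Fact (0 < (F.P K).eta k)] [Fact (0 < c0Rec F K k)] [Fact (∀ c, 0 < wBRec F K k c)]

/-! ## §1. The instance of record -/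

/-- ★★★ **THE [B11] PROP. 6 SCHEME OF RECORD AT THE BACKGROUND `U₀`** (`BgSchemeOnLit F N K k Ω U₀`): domain `dom` (datum); `bg := U₀`;
`𝒢 := 𝔊(U₀)` for the slot-(c) Hessian `π†(Δ(U₀) + Δ⁽²⁾)π` (`frakGOfRecordAtBg128`); `W :=` (80)'s `W` with Sect. C's flat `H♭` and `C` on the
traceless slice (`WOfRecordAt`); `J := J(U₀)` (`JOfRecordAtBg`); `𝔄 V := H₁B(V)` (`frakAOfRecordAtBg128`); constants `B₀ C₄ a₃ j a𝔄 ε₄` data;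
`ev := η·ev` ((19): `U′ = exp(iηA′)`).  Data letters: `G′ =: Gp`, `Δ⁽²⁾ =: Δ2`, Landau `a`, `levB`, `ε_C`; displayed proofs: `hposπ` (Thm 3.12,
slot (c)), `hpos♭` (Thm 3.11, bare slot — Sect. C's `H♭` in `W`), `hQ`.  No law is a field; the laws are the tokens of §2 and of file 3a.
[cite: Balaban1985Variational, Prop. 6 (115)–(117) p.295, (14) p.280, (19) p.281, (80) p.290, (103) p.293, (111) p.294; Balaban1985BackgroundPropagators, (3.128) p.421, (3.134) p.422] -/
def bgSchemeOfRecord (dom : Set (GaugeField (F.P K) k (SU N))) (levB : PBond (F.P K) k → ℕ)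
    (Gp : SiteL2K ℂ (F.P K).d (fun _ => (F.P K).sitesPerDir 0) (c0Rec F K k) (WRec N) →ₗ[ℂ]
      SiteL2K ℂ (F.P K).d (fun _ => (F.P K).sitesPerDir 0) (c0Rec F K k) (WRec N))
    (Δ2 : BondL2K ℂ (F.P K).d (fun _ => (F.P K).sitesPerDir 0) (c0Rec F K k) (WRec N) →ₗ[ℂ]
      BondL2K ℂ (F.P K).d (fun _ => (F.P K).sitesPerDir 0) (c0Rec F K k) (WRec N)) (a : ℝ)
    (hposπ : ∀ x, x ≠ 0 → 0 < RCLike.re ⟪x, laplaceAOfRecordAt F N k U₀ (hessOpOfRecord128 F N k U₀ Gp (QflatOfRecord F N k) Δ2)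
      (QOfRecord F N k U₀) (QflatOfRecord F N k) a x⟫_ℂ)
    (hposb : ∀ x, x ≠ 0 → 0 < RCLike.re ⟪x, laplaceAOfRecord F N k U₀ (QOfRecord F N k U₀) (QflatOfRecord F N k) a x⟫_ℂ)
    (hQ : Function.Surjective (QOfRecord F N k U₀)) (εC B₀ C₄ a₃ j a𝔄 ε₄ : ℝ) : BgSchemeOnLit F N K k Ω U₀ where
  dom := dom
  bg := fun _ => U₀
  𝒢 := fun _ => frakGOfRecordAtBg128 F N K k Ω U₀ Gp Δ2 a hposπ hQ
  W := fun _ => WOfRecordAt F N K k Ω U₀ levB a hposb hQ εC Gp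
  J := fun _ => JOfRecordAtBg F N K k Ω U₀
  𝔄 := frakAOfRecordAtBg128 F N K k Ω U₀ levB Gp Δ2 a hposπ hQ
  B₀ := B₀
  C₄ := C₄
  a₃ := a₃
  j := j
  a := a𝔄
  ε₄ := ε₄
  ev := ((F.P K).eta k : ℂ) • evLit F N K k Ω U₀

section Projections

variable (dom : Set (GaugeField (F.P K) k (SU N))) (levB : PBond (F.P K) k → ℕ)
  (Gp : SiteL2K ℂ (F.P K).d (fun _ => (F.P K).sitesPerDir 0) (c0Rec F K k) (WRec N) →ₗ[ℂ]
    SiteL2K ℂ (F.P K).d (fun _ => (F.P K).sitesPerDir 0) (c0Rec F K k) (WRec N))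
  (Δ2 : BondL2K ℂ (F.P K).d (fun _ => (F.P K).sitesPerDir 0) (c0Rec F K k) (WRec N) →ₗ[ℂ]
    BondL2K ℂ (F.P K).d (fun _ => (F.P K).sitesPerDir 0) (c0Rec F K k) (WRec N)) (a : ℝ)
  (hposπ : ∀ x, x ≠ 0 → 0 < RCLike.re ⟪x, laplaceAOfRecordAt F N k U₀ (hessOpOfRecord128 F N k U₀ Gp (QflatOfRecord F N k) Δ2)
    (QOfRecord F N k U₀) (QflatOfRecord F N k) a x⟫_ℂ)
  (hposb : ∀ x, x ≠ 0 → 0 < RCLike.re ⟪x, laplaceAOfRecord F N k U₀ (QOfRecord F N k U₀) (QflatOfRecord F N k) a x⟫_ℂ)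
  (hQ : Function.Surjective (QOfRecord F N k U₀)) (εC B₀ C₄ a₃ j a𝔄 ε₄ : ℝ) (V : GaugeField (F.P K) k (SU N))

/-- `bg V = U₀` (the background is the displayed datum). [cite: Balaban1985Variational, (14) p.280] -/
theorem bgSchemeOfRecord_bg : (bgSchemeOfRecord F N K k Ω U₀ dom levB Gp Δ2 a hposπ hposb hQ εC B₀ C₄ a₃ j a𝔄 ε₄).bg V = U₀ := rfl

/-- `𝒢 V = 𝔊(U₀)` for the slot-(c) Hessian. [cite: Balaban1985Variational, (111) p.294, (116) p.295] -/
theorem bgSchemeOfRecord_𝒢 : (bgSchemeOfRecord F N K k Ω U₀ dom levB Gp Δ2 a hposπ hposb hQ εC B₀ C₄ a₃ j a𝔄 ε₄).𝒢 V =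
    frakGOfRecordAtBg128 F N K k Ω U₀ Gp Δ2 a hposπ hQ := rfl

/-- `W V = W` of (80) at the record. [cite: Balaban1985Variational, (80) p.290, (116) p.295] -/
theorem bgSchemeOfRecord_W : (bgSchemeOfRecord F N K k Ω U₀ dom levB Gp Δ2 a hposπ hposb hQ εC B₀ C₄ a₃ j a𝔄 ε₄).W V =
    WOfRecordAt F N K k Ω U₀ levB a hposb hQ εC Gp := rfl

/-- `J V = J(U₀)`. [cite: Balaban1985Variational, (26)–(28) p.282] -/
theorem bgSchemeOfRecord_J : (bgSchemeOfRecord F N K k Ω U₀ dom levB Gp Δ2 a hposπ hposb hQ εC B₀ C₄ a₃ j a𝔄 ε₄).J V =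
    JOfRecordAtBg F N K k Ω U₀ := rfl

/-- `𝔄 V = H₁B(V)`. [cite: Balaban1985Variational, (103) p.293] -/
theorem bgSchemeOfRecord_𝔄 : (bgSchemeOfRecord F N K k Ω U₀ dom levB Gp Δ2 a hposπ hposb hQ εC B₀ C₄ a₃ j a𝔄 ε₄).𝔄 V =
    frakAOfRecordAtBg128 F N K k Ω U₀ levB Gp Δ2 a hposπ hQ V := rfl

/-- `ev = η·ev` (the (19) presentation). [cite: Balaban1985Variational, (19) p.281] -/
theorem bgSchemeOfRecord_ev : (bgSchemeOfRecord F N K k Ω U₀ dom levB Gp Δ2 a hposπ hposb hQ εC B₀ C₄ a₃ j a𝔄 ε₄).ev =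
    ((F.P K).eta k : ℂ) • evLit F N K k Ω U₀ := rfl

/-- The domain is the datum `dom`. [cite: Balaban1985Variational, (7) p.279] -/
theorem bgSchemeOfRecord_dom : (bgSchemeOfRecord F N K k Ω U₀ dom levB Gp Δ2 a hposπ hposb hQ εC B₀ C₄ a₃ j a𝔄 ε₄).dom = dom := rfl

/-- ★ **THE FIXED POINT OF (116) AT THE RECORD, UNFOLDED**: `𝒜(V) = solA 𝔊(U₀) 0 W J(U₀) ε₄ (H₁B(V))` — lit's selected solution of
`X = −𝒢J − 𝒢W(X + 𝔄)` in `‖X‖ ≤ ε₄` with the record's letters in every slot (`rfl`). [cite: Balaban1985Variational, Prop. 6 (116) p.295] -/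
theorem bgSchemeOfRecord_sol : (bgSchemeOfRecord F N K k Ω U₀ dom levB Gp Δ2 a hposπ hposb hQ εC B₀ C₄ a₃ j a𝔄 ε₄).sol V =
    solA (frakGOfRecordAtBg128 F N K k Ω U₀ Gp Δ2 a hposπ hQ) 0 (WOfRecordAt F N K k Ω U₀ levB a hposb hQ εC Gp)
      (JOfRecordAtBg F N K k Ω U₀) ε₄ (frakAOfRecordAtBg128 F N K k Ω U₀ levB Gp Δ2 a hposπ hQ V) := rfl

/-- E2: **the shift vanishes at the averaged background** — `𝔄(Ū^k U₀) = 0` (3f′ `frakAOfRecordAtBg128_self`, 3e′ `BOfRecord_self`).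
[cite: Balaban1985Variational, (20) p.281, (103) p.293] -/
theorem bgSchemeOfRecord_𝔄_self :
    (bgSchemeOfRecord F N K k Ω U₀ dom levB Gp Δ2 a hposπ hposb hQ εC B₀ C₄ a₃ j a𝔄 ε₄).𝔄 (Averaging.iter (avOfRecord F N K) k U₀) = 0 :=
  frakAOfRecordAtBg128_self F N K k Ω U₀ levB Gp Δ2 a hposπ hQ

/-- ★ **THE CHART IMAGE OF THE FIXED POINT IS 3e′'s CHART `expOver U₀ X` AT `X = η·ev(𝒜(V) + 𝔄(V))`** — «U = U′U₀, U′ = exp(iηA′)» on the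
matrices, on the bonds where the exponent is `su(N)`-valued (`ChartSUTok`'s bonds; lit `coe_chartCfg_of_mem`).  This is the socket of file 3e′'s
`COfRecord`∕`BOfRecord` (both written over `expOver U₀`). [cite: Balaban1985Variational, (15) p.280, (19) p.281, Prop. 6 p.295] -/
theorem bgSchemeOfRecord_coe_chartCfg {V : GaugeField (F.P K) k (SU N)} {b : PBond (F.P K) 0}
    (h : (bgSchemeOfRecord F N K k Ω U₀ dom levB Gp Δ2 a hposπ hposb hQ εC B₀ C₄ a₃ j a𝔄 ε₄).expo V b ∈
      Matrix.specialUnitaryGroup (Fin N) ℂ) :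
    (((bgSchemeOfRecord F N K k Ω U₀ dom levB Gp Δ2 a hposπ hposb hQ εC B₀ C₄ a₃ j a𝔄 ε₄).chartCfg V b : SU N) : Matrix (Fin N) (Fin N) ℂ) =
      expOver U₀ ((bgSchemeOfRecord F N K k Ω U₀ dom levB Gp Δ2 a hposπ hposb hQ εC B₀ C₄ a₃ j a𝔄 ε₄).ev
        ((bgSchemeOfRecord F N K k Ω U₀ dom levB Gp Δ2 a hposπ hposb hQ εC B₀ C₄ a₃ j a𝔄 ε₄).sol V +
          (bgSchemeOfRecord F N K k Ω U₀ dom levB Gp Δ2 a hposπ hposb hQ εC B₀ C₄ a₃ j a𝔄 ε₄).𝔄 V)) b := by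
  rw [BgScheme.coe_chartCfg_of_mem _ h]
  rfl

end Projections

/-- E2: **at the unit background the current vanishes** — `J(1) = 0` in the scheme of record at `U₀ = 1` (3d′ `JOfRecordAtBg_one`).
[cite: Balaban1985Variational, (26)–(28) p.282] -/
theorem bgSchemeOfRecord_J_one (dom : Set (GaugeField (F.P K) k (SU N))) (levB : PBond (F.P K) k → ℕ)
    (Gp : SiteL2K ℂ (F.P K).d (fun _ => (F.P K).sitesPerDir 0) (c0Rec F K k) (WRec N) →ₗ[ℂ]
      SiteL2K ℂ (F.P K).d (fun _ => (F.P K).sitesPerDir 0) (c0Rec F K k) (WRec N))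
    (Δ2 : BondL2K ℂ (F.P K).d (fun _ => (F.P K).sitesPerDir 0) (c0Rec F K k) (WRec N) →ₗ[ℂ]
      BondL2K ℂ (F.P K).d (fun _ => (F.P K).sitesPerDir 0) (c0Rec F K k) (WRec N)) (a : ℝ)
    (hposπ : ∀ x, x ≠ 0 → 0 < RCLike.re ⟪x, laplaceAOfRecordAt F N k 1 (hessOpOfRecord128 F N k 1 Gp (QflatOfRecord F N k) Δ2)
      (QOfRecord F N k 1) (QflatOfRecord F N k) a x⟫_ℂ)
    (hposb : ∀ x, x ≠ 0 → 0 < RCLike.re ⟪x, laplaceAOfRecord F N k 1 (QOfRecord F N k 1) (QflatOfRecord F N k) a x⟫_ℂ)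
    (hQ : Function.Surjective (QOfRecord F N k (1 : GaugeField (F.P K) 0 (SU N)))) (εC B₀ C₄ a₃ j a𝔄 ε₄ : ℝ)
    (V : GaugeField (F.P K) k (SU N)) :
    (bgSchemeOfRecord F N K k Ω 1 dom levB Gp Δ2 a hposπ hposb hQ εC B₀ C₄ a₃ j a𝔄 ε₄).J V = 0 :=
  JOfRecordAtBg_one

/-! ## §2. The displayed tokens the instance is read with (NOT asserted) -/

/-- **TOKEN — [B9] (3.134): `Δ⁽²⁾` IS THE OPERATOR OF THE SECOND QUADRATIC FORM OF (3.128)**, «`⟨A, Δ⁽²⁾A⟩ = −2⟨HC⁽²⁾(A), J⟩`», at the record's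
letters: the pairing (27) `pair27 τ` of the `Δ2`-current of `A` (lit `currentCLM`, the bilinear-transpose reading) against `A` equals `−2×` the
pairing of `J(U₀)` against `H♭(C⁽²⁾(A))`, `C⁽²⁾ := quadPart C^{𝔰𝔩}` ((56), on the traceless slice), `H♭` Sect. C's (45)–(47) (= [B9] (3.126)'s
`H` of the problem (3.109)–(3.110)).  With `Delta2SymmTok` this determines `Δ2` (polarisation).  DISPLAYED, never asserted; the existence of such a
`Δ2` is linear algebra, a separate support statement. [cite: Balaban1985BackgroundPropagators, (3.134) p.422, (3.127)–(3.128) p.421; Balaban1985Variational, (78)–(79) p.290, (56) p.286, (27) p.282] -/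
def Delta2Tok (levB : PBond (F.P K) k → ℕ) (a : ℝ)
    (hposb : ∀ x, x ≠ 0 → 0 < RCLike.re ⟪x, laplaceAOfRecord F N k U₀ (QOfRecord F N k U₀) (QflatOfRecord F N k) a x⟫_ℂ)
    (hQ : Function.Surjective (QOfRecord F N k U₀))
    (Δ2 : BondL2K ℂ (F.P K).d (fun _ => (F.P K).sitesPerDir 0) (c0Rec F K k) (WRec N) →ₗ[ℂ]
      BondL2K ℂ (F.P K).d (fun _ => (F.P K).sitesPerDir 0) (c0Rec F K k) (WRec N)) : Prop :=
  ∀ A : Space115Lit F N K k Ω U₀,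
    pair27 (tauRecCLM N)
        (currentCLM (phiRec N) (pairLevLit F Ω k) (nabla115 ((F.P K).eta k) (unitsOfRecord F N U₀)) Δ2 A) (flat115 A) =
      -2 * pair27 (tauRecCLM N) (JOfRecordAtBg F N K k Ω U₀)
        (flat115 (H1OfRecordAtBgFlat F N K k Ω U₀ levB a hposb hQ (quadPart (CslOfRecord F N K k Ω U₀ levB) A)))

/-- **TOKEN — `Δ⁽²⁾` is symmetric for the pairing (27)** (a quadratic form's operator; the `hΔ` shape of lit `pair27_W80`).
[cite: Balaban1985BackgroundPropagators, (3.134)–(3.135) p.422] -/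
def Delta2SymmTok
    (Δ2 : BondL2K ℂ (F.P K).d (fun _ => (F.P K).sitesPerDir 0) (c0Rec F K k) (WRec N) →ₗ[ℂ]
      BondL2K ℂ (F.P K).d (fun _ => (F.P K).sitesPerDir 0) (c0Rec F K k) (WRec N)) : Prop :=
  ∀ Y Z : Space115Lit F N K k Ω U₀,
    pair27 (tauRecCLM N) (currentCLM (phiRec N) (pairLevLit F Ω k) (nabla115 ((F.P K).eta k) (unitsOfRecord F N U₀)) Δ2 Y) (flat115 Z) =
      pair27 (tauRecCLM N) (currentCLM (phiRec N) (pairLevLit F Ω k) (nabla115 ((F.P K).eta k) (unitsOfRecord F N U₀)) Δ2 Z) (flat115 Y)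

omit [NeZero N] [Fact (0 < (F.L : ℝ))] [Fact (0 < (F.P K).eta k)] [Fact (∀ c, 0 < wBRec F K k c)] in
/-- **TOKEN — the slot-(c) operator `Δ(U₀) + Δ⁽²⁾` is Hilbert-symmetric** (the `hΔ` letter of [B9] (3.124)'s third identity `RD*G̃₁Q* = 0`, lit
`h124'_RLatticeK`).  For `Δ(U₀)` alone this is star-algebra at every background (Summit side, n07 lane, from lit `hessOp_isSymmetric_of_trace`); the
content under the row's hypotheses `Delta2Tok ∧ Delta2SymmTok` (which determine `Δ2` uniquely: `flat115` is a bijection, `currentCLM` is injective,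
`pair27 tr` is perfect) is the REALITY of print's `Δ⁽²⁾` — transpose-symmetric ⇒ Hilbert-symmetric. [cite: Balaban1985BackgroundPropagators, (3.124) p.420, (3.128) p.421, (3.134) p.422] -/
def HessSymmTok
    (Δ2 : BondL2K ℂ (F.P K).d (fun _ => (F.P K).sitesPerDir 0) (c0Rec F K k) (WRec N) →ₗ[ℂ]
      BondL2K ℂ (F.P K).d (fun _ => (F.P K).sitesPerDir 0) (c0Rec F K k) (WRec N)) : Prop :=
  (hessOpOfRecord F N k U₀ + Δ2).IsSymmetric

omit [Fact (0 < c0Rec F K k)] [Fact (∀ c, 0 < wBRec F K k c)] in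
/-- **TOKEN — (44)∕(56) «`C` IS OF SECOND ORDER» ON PRINT'S `𝔤ᶜ`-VALUED FIELDS**: `DC^{𝔰𝔩}(0) = 0` (T-C1′ of the cell; review seats RR-2 ∕ n07-w3,
2026-08-31: true-shaped on the traceless slice only — along Hermitian traceless directions the adjugate-continued averaging is the unitary one and the
chart's derivative is `Q_k(U₀)`, which `C` subtracts; FALSE for the bare `COfRecord` along `A′ = a·1`).  Typed as `HasFDerivAt … 0 0` (differentiable
AND derivative zero), not as `fderiv … 0 = 0`, whose junk value `0` off differentiability would make the token vacuous without the guard on `U₀`.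
[cite: Balaban1985Variational, (44) p.285, (56) p.286, (51) p.286] -/
def C1Tok (levB : PBond (F.P K) k → ℕ) : Prop :=
  HasFDerivAt (CslOfRecord F N K k Ω U₀ levB)
    (0 : Space115Lit F N K k Ω U₀ →L[ℂ] NegSize (F.L : ℝ) ((F.P K).eta k) levB 0 (Matrix (Fin N) (Fin N) ℂ)) 0

/-- ★ **THE TOKEN BUNDLE A STATEMENT ROW OVER THE INSTANCE CONCLUDES** (row text; the ROW's binders are the ceiling-first constants, the `∀` over
the admissible data `Gp`, `Δ2`, the guard on `U₀`, the displayed proofs, and the HYPOTHESES `Delta2Tok … Δ2`, `Delta2SymmTok … Δ2` pinning print's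
`Δ⁽²⁾` — which therefore are NOT conjuncts here, review seat RR-2 (α) 2026-08-31): Prop. 6's regime (117)–(121) with (28), (103) at the instance
(`RegimeTok`, whose `quad` field is Prop. 4 (98) for `W` over `C^{𝔰𝔩}` and whose `𝒢`-bound is (117)), reality of the fixed point (`ChartSUTok`),
the Hilbert-symmetry of `Δ(U₀) + Δ2` (`HessSymmTok` — genuine content under the hypotheses: (3.134) + transpose-symmetry determine `Δ2` uniquely,
so the conjunct says print's `Δ⁽²⁾` is real), and `DC^{𝔰𝔩}(0) = 0` (`C1Tok`).  Prop. 7 ∕ Thm 1's uniqueness stay the separate tokens `Prop7Tok ε` ∕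
`UniqTok ε` of file 3a (they carry the radius `ε`).  DISPLAYED, never asserted.
[cite: Balaban1985Variational, Prop. 6 (115)–(121) p.295, Prop. 4 (98) p.293; Balaban1985BackgroundPropagators, (3.134) p.422] -/
def SchemeTokOfRecord (dom : Set (GaugeField (F.P K) k (SU N))) (levB : PBond (F.P K) k → ℕ)
    (Gp : SiteL2K ℂ (F.P K).d (fun _ => (F.P K).sitesPerDir 0) (c0Rec F K k) (WRec N) →ₗ[ℂ]
      SiteL2K ℂ (F.P K).d (fun _ => (F.P K).sitesPerDir 0) (c0Rec F K k) (WRec N))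
    (Δ2 : BondL2K ℂ (F.P K).d (fun _ => (F.P K).sitesPerDir 0) (c0Rec F K k) (WRec N) →ₗ[ℂ]
      BondL2K ℂ (F.P K).d (fun _ => (F.P K).sitesPerDir 0) (c0Rec F K k) (WRec N)) (a : ℝ)
    (hposπ : ∀ x, x ≠ 0 → 0 < RCLike.re ⟪x, laplaceAOfRecordAt F N k U₀ (hessOpOfRecord128 F N k U₀ Gp (QflatOfRecord F N k) Δ2)
      (QOfRecord F N k U₀) (QflatOfRecord F N k) a x⟫_ℂ)
    (hposb : ∀ x, x ≠ 0 → 0 < RCLike.re ⟪x, laplaceAOfRecord F N k U₀ (QOfRecord F N k U₀) (QflatOfRecord F N k) a x⟫_ℂ)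
    (hQ : Function.Surjective (QOfRecord F N k U₀)) (εC B₀ C₄ a₃ j a𝔄 ε₄ : ℝ) : Prop :=
  (bgSchemeOfRecord F N K k Ω U₀ dom levB Gp Δ2 a hposπ hposb hQ εC B₀ C₄ a₃ j a𝔄 ε₄).RegimeTok ∧
    (bgSchemeOfRecord F N K k Ω U₀ dom levB Gp Δ2 a hposπ hposb hQ εC B₀ C₄ a₃ j a𝔄 ε₄).ChartSUTok ∧
      HessSymmTok F N K k U₀ Δ2 ∧ C1Tok F N K k Ω U₀ levB

/-- Reading the bundle: its first conjunct IS Prop. 6's regime token of the instance (so lit ✓`B11Prop6Scheme.existsUnique_solution` ∕ 3a's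
`analyticOnNhd_sol_comp` apply to `(bgSchemeOfRecord …).sol` once a row proves it). [cite: Balaban1985Variational, Prop. 6 p.295 (bookkeeping)] -/
theorem SchemeTokOfRecord.regimeTok {dom : Set (GaugeField (F.P K) k (SU N))} {levB : PBond (F.P K) k → ℕ}
    {Gp : SiteL2K ℂ (F.P K).d (fun _ => (F.P K).sitesPerDir 0) (c0Rec F K k) (WRec N) →ₗ[ℂ]
      SiteL2K ℂ (F.P K).d (fun _ => (F.P K).sitesPerDir 0) (c0Rec F K k) (WRec N)}
    {Δ2 : BondL2K ℂ (F.P K).d (fun _ => (F.P K).sitesPerDir 0) (c0Rec F K k) (WRec N) →ₗ[ℂ]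
      BondL2K ℂ (F.P K).d (fun _ => (F.P K).sitesPerDir 0) (c0Rec F K k) (WRec N)} {a : ℝ}
    {hposπ : ∀ x, x ≠ 0 → 0 < RCLike.re ⟪x, laplaceAOfRecordAt F N k U₀ (hessOpOfRecord128 F N k U₀ Gp (QflatOfRecord F N k) Δ2)
      (QOfRecord F N k U₀) (QflatOfRecord F N k) a x⟫_ℂ}
    {hposb : ∀ x, x ≠ 0 → 0 < RCLike.re ⟪x, laplaceAOfRecord F N k U₀ (QOfRecord F N k U₀) (QflatOfRecord F N k) a x⟫_ℂ}
    {hQ : Function.Surjective (QOfRecord F N k U₀)} {εC B₀ C₄ a₃ j a𝔄 ε₄ : ℝ}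
    (h : SchemeTokOfRecord F N K k Ω U₀ dom levB Gp Δ2 a hposπ hposb hQ εC B₀ C₄ a₃ j a𝔄 ε₄) :
    (bgSchemeOfRecord F N K k Ω U₀ dom levB Gp Δ2 a hposπ hposb hQ εC B₀ C₄ a₃ j a𝔄 ε₄).RegimeTok :=
  h.1

end Record

end Literature.MathematicalPhysics.QuantumFieldTheory.Balaban1983to89.Node00

end
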